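import Mathlib
import HarnessLib

/-!
# Rigid matrices reduce to range avoidance for degree-2 maps (Gajulapalli–Golovnev–Nagargoje–Saraogi 2023)

**Lemma 2** [GGNS23, Lemma 2].  «For every `d ≥ 1` and every polynomial-time computable `s := s(n) < n^{1−1/d}/d`,
there exists a polynomial-time computable function `f : 𝔽₂^{d·s·n^{1/d}} → 𝔽₂ⁿ` whose range contains all vectors
of sparsity at most `s`, and each output of `f` is a degree-`d` polynomial.»  Construction (ibid., proof): fix a
`d`-uniform hypergraph with `ℓ = d·n^{1/d}` vertices and `n` hyperedges; the input is a label `X_j ∈ 𝔽₂ˢ` per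
vertex; output `i` is the generalised inner product `Σ_{k ≤ s} Π_{j ∈ e_i} X_{k,j}` of the labels on hyperedge
`e_i`.  Here: `sparseEnc e s` for ANY injective `d`-uniform `e : Fin n → Finset (Fin ℓ)` (`d ≥ 1`), and
`exists_sparseEnc_eq` — every `y` of sparsity `≤ s` is attained (the hypergraph with the printed vertex count
exists whenever `n ≤ C(ℓ, d)`; `exists_twoUniform` records the graph case `d = 2`).

**Theorem 2** [GGNS23, Thm. 2, first part].  «For every constant `1/2 ≤ δ ≤ 1`, an FP (resp. FP^NP) algorithm
for degree-2-AVOID with stretch `m = 2n^{2/(1+δ)}` will provide an FP (resp. FP^NP) algorithm for finding an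
`(n^δ/10, n^{δ−1/2}/10)`-rigid matrix.»  Its mathematical content (ibid., proof): with `r, s` the rigidity
parameters, the DEGREE-2 map `g : 𝔽₂^{2rn + 2sn^{3/2}} → 𝔽₂^{n²}`, `g(L, R, X) = L·R + S(X)` (row `i` of `S`
= the `d = 2` sparse encoder applied to the label block `X^{(i)}`, graph on `2√n` vertices with `n` edges),
has every NON-`(r,s)`-rigid matrix in its range — «A solution to degree-2-AVOID on input `g` would therefore
give an `(r, s)`-rigid matrix».  Here: `rigidityMap e r s` (inputs indexed by
`RigIn N r s ℓ = (N×r) ⊕ (r×N) ⊕ (N×s×ℓ)`, `card_rigIn`), `exists_rigidityMap_eq` (non-rigid ⇒ in the range) and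
`isRigid_of_not_mem_range` (a non-image IS rigid).  Rigidity as printed (ibid., §1.1): «`M ∈ 𝔽₂^{n×n}` is
called `(r,s)`-rigid if it cannot be written as a sum `M = L + S` of a rank-`r` matrix `L` and a matrix `S` with
at most `s` non-zeros PER ROW»; rank `≤ r` is recorded, as in the printed proof («`Q = L·R` for some matrices
`L, Rᵀ ∈ 𝔽₂^{n×r}`»), by a factorisation through `𝔽₂ʳ`; `exists_mul_eq_of_rank_le` / `isRigid_iff_rank` show this is the same as
«rank `≤ r`» via `Matrix.rank` (`rank_mul_le`: such products have `Matrix.rank ≤ r`).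
The complexity-theoretic wrapper (an AVOID algorithm run on `g` outputs a rigid matrix; at `δ = 1` the instance
has `n' = 2n²/5` inputs, `n²` outputs — stretch `2.5·n'` — and the output is `(n/10, √n/10)`-rigid, i.e.
Valiant-rigid) is the displayed sentence and is not re-formalised.

## References
* K. Gajulapalli, A. Golovnev, S. Nagargoje, S. Saraogi, *Range Avoidance for Constant-Depth Circuits: Hardness
  and Algorithms*, APPROX/RANDOM 2023 (LIPIcs 275) / arXiv:2303.05044, §1.1, §3 (Lemma 2, Theorem 2).
  bib `GajulapalliEtAl2023`.
* L. G. Valiant, *Graph-theoretic arguments in low-level complexity*, MFCS 1977 (the rigidity ⇒ linear-circuit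
  lower bound the reduction targets; quoted from GGNS §1.1).
-/

namespace Literature.Computability.Complexity

namespace DegreeTwoAvoid

open Finset

/-! ### GGNS Lemma 2: a degree-`d` map whose range contains all `s`-sparse vectors -/

section SparseEncoder

variable {ℓ n : ℕ}

/-- GGNS's sparse-vector encoder on a hypergraph `e` (`n` hyperedges on `ℓ` vertices) with `s` label rows:
output `i` is `Σ_{k < s} Π_{j ∈ e i} X_{k,j}` — a sum of `s` monomials of degree `|e i|`.
[cite: GajulapalliEtAl2023, Lemma 2 (proof)] -/
def sparseEnc (e : Fin n → Finset (Fin ℓ)) (s : ℕ) (X : Fin s → Fin ℓ → ZMod 2) : Fin n → ZMod 2 :=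
  fun i => ∑ k : Fin s, ∏ j ∈ e i, X k j

/-- Elements of `𝔽₂` are `0` or `1`. [folklore] -/
private theorem zmod2_eq_zero_or_one (a : ZMod 2) : a = 0 ∨ a = 1 := by
  revert a; decide

/-- **GGNS Lemma 2.**  On an injective `d`-uniform hypergraph (`d ≥ 1`) the encoder with `s` label rows attains
every vector with at most `s` non-zero entries: label row `k` with the indicator of the `k`-th hyperedge of the
support; on hyperedge `i` the `k`-th product is `1` iff `e i ⊆ e (i_k)` iff `i = i_k`.
[cite: GajulapalliEtAl2023, Lemma 2] -/
theorem exists_sparseEnc_eq {d s : ℕ} (e : Fin n → Finset (Fin ℓ)) (hcard : ∀ i, (e i).card = d)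
    (hd : 0 < d) (hinj : Function.Injective e) (y : Fin n → ZMod 2)
    (hy : (Finset.univ.filter fun i => y i ≠ 0).card ≤ s) :
    ∃ X : Fin s → Fin ℓ → ZMod 2, sparseEnc e s X = y := by
  classical
  set supp : Finset (Fin n) := Finset.univ.filter fun i => y i ≠ 0 with hsupp
  -- an injection of the support into the label rows
  let ι : supp ↪ Fin s := supp.equivFin.toEmbedding.trans (Fin.castLEEmb hy)
  -- row `ι i₀` carries the indicator vector of the hyperedge `e i₀`; unused rows are zero
  let X : Fin s → Fin ℓ → ZMod 2 := fun k j => if ∃ i₀ : supp, ι i₀ = k ∧ j ∈ e i₀ then 1 else 0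
  refine ⟨X, funext fun i => ?_⟩
  -- the `k`-th product on hyperedge `i` is the indicator of «`k = ι i₀` with `i₀ = i`»
  have hiff : ∀ k : Fin s, (∀ j ∈ e i, ∃ i₀ : supp, ι i₀ = k ∧ j ∈ e (i₀ : Fin n)) ↔
      ∃ i₀ : supp, ι i₀ = k ∧ (i₀ : Fin n) = i := by
    intro k
    constructor
    · intro h
      have hne : (e i).Nonempty := by
        rw [← Finset.card_pos, hcard i]; exact hd
      obtain ⟨j, hj⟩ := hne
      obtain ⟨i₀, hk, hj₀⟩ := h j hj
      refine ⟨i₀, hk, ?_⟩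
      have hsub : e i ⊆ e i₀ := by
        intro j' hj'
        obtain ⟨i₁, hk₁, hj₁⟩ := h j' hj'
        have : i₁ = i₀ := ι.injective (hk₁.trans hk.symm)
        rw [this] at hj₁
        exact hj₁
      have heq : e i = e (i₀ : Fin n) :=
        Finset.eq_of_subset_of_card_le hsub (by rw [hcard, hcard])
      exact (hinj heq).symm
    · rintro ⟨i₀, hk, hi⟩ j hj
      exact ⟨i₀, hk, by rw [hi]; exact hj⟩
  have hprod : ∀ k : Fin s, (∏ j ∈ e i, X k j) =
      if ∃ i₀ : supp, ι i₀ = k ∧ (i₀ : Fin n) = i then 1 else 0 := by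
    intro k
    rw [Finset.prod_boole]
    by_cases hq : ∃ i₀ : supp, ι i₀ = k ∧ (i₀ : Fin n) = i
    · rw [if_pos hq, if_pos ((hiff k).2 hq)]
    · rw [if_neg hq, if_neg (fun h => hq ((hiff k).1 h))]
  show (∑ k : Fin s, ∏ j ∈ e i, X k j) = y i
  simp only [hprod]
  by_cases hi : i ∈ supp
  · -- exactly one row, `ι ⟨i, hi⟩`, contributes
    have hrw : ∀ k : Fin s, (∃ i₀ : supp, ι i₀ = k ∧ (i₀ : Fin n) = i) ↔ k = ι ⟨i, hi⟩ := by
      intro k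
      constructor
      · rintro ⟨i₀, hk, hi₀⟩
        have : i₀ = ⟨i, hi⟩ := Subtype.ext hi₀
        rw [← hk, this]
      · intro hk; exact ⟨⟨i, hi⟩, hk.symm, rfl⟩
    simp only [hrw, Finset.sum_ite_eq', Finset.mem_univ, if_true]
    have hyi : y i ≠ 0 := (Finset.mem_filter.1 hi).2
    rcases zmod2_eq_zero_or_one (y i) with h | h
    · exact (hyi h).elim
    · exact h.symm
  · -- no row contributes
    have hrw : ∀ k : Fin s, ¬ ∃ i₀ : supp, ι i₀ = k ∧ (i₀ : Fin n) = i := by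
      rintro k ⟨i₀, -, hi₀⟩
      exact hi (hi₀ ▸ i₀.2)
    simp only [hrw, if_false, Finset.sum_const_zero]
    have : ¬ (y i ≠ 0) := fun h => hi (Finset.mem_filter.2 ⟨Finset.mem_univ _, h⟩)
    exact (not_not.1 this).symm

/-- A graph (`2`-uniform hypergraph) with `N` distinct edges on `ℓ` vertices exists as soon as `N ≤ C(ℓ,2)`
(GGNS take `ℓ = 2√n`: «such a graph exists because `C(ℓ,d) ≥ (ℓ/d)^d = n`»).
[cite: GajulapalliEtAl2023, Lemma 2 (proof)] -/
theorem exists_twoUniform {N : ℕ} (hN : N ≤ ℓ.choose 2) :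
    ∃ e : Fin N → Finset (Fin ℓ), (∀ j, (e j).card = 2) ∧ Function.Injective e := by
  classical
  set P : Finset (Finset (Fin ℓ)) := (Finset.univ : Finset (Fin ℓ)).powersetCard 2 with hP
  have hPc : P.card = ℓ.choose 2 := by
    rw [hP, Finset.card_powersetCard, Finset.card_univ, Fintype.card_fin]
  let f : Fin N ↪ P := (Fin.castLEEmb (hN.trans_eq hPc.symm)).trans P.equivFin.symm.toEmbedding
  refine ⟨fun j => (f j).1, fun j => (Finset.mem_powersetCard.1 (f j).2).2, fun a b h => ?_⟩
  exact f.injective (Subtype.ext h)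

end SparseEncoder

/-! ### GGNS Theorem 2: non-rigid matrices lie in the range of a degree-2 map -/

section Rigidity

variable {N : ℕ}

/-- `S` has at most `s` non-zero entries in every row. [cite: GajulapalliEtAl2023, §1.1 ((r,s)-rigid)] -/
def RowSparse (s : ℕ) (S : Matrix (Fin N) (Fin N) (ZMod 2)) : Prop :=
  ∀ i, (Finset.univ.filter fun j => S i j ≠ 0).card ≤ s

/-- **`(r, s)`-rigidity** as in GGNS §1.1: `M` is NOT the sum of a matrix of rank `≤ r` — recorded as a product
`L·R` through `𝔽₂ʳ`, as in the printed proof of Thm. 2 — and an `s`-row-sparse matrix.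
[cite: GajulapalliEtAl2023, §1.1 and Thm. 2 (proof: «Q = L·R for some matrices L, Rᵀ ∈ 𝔽₂^{n×r}»)] -/
def IsRigid (r s : ℕ) (M : Matrix (Fin N) (Fin N) (ZMod 2)) : Prop :=
  ∀ (L : Matrix (Fin N) (Fin r) (ZMod 2)) (R : Matrix (Fin r) (Fin N) (ZMod 2))
    (S : Matrix (Fin N) (Fin N) (ZMod 2)), RowSparse s S → M ≠ L * R + S

/-- A product through `𝔽₂ʳ` has rank at most `r`. [cite: GajulapalliEtAl2023, Thm. 2 (proof)] -/
theorem rank_mul_le {r : ℕ} (L : Matrix (Fin N) (Fin r) (ZMod 2)) (R : Matrix (Fin r) (Fin N) (ZMod 2)) :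
    (L * R).rank ≤ r :=
  (Matrix.rank_mul_le_left L R).trans ((Matrix.rank_le_card_width L).trans (by simp))

/-- The input coordinates of GGNS's map `g`: the entries of `L ∈ 𝔽₂^{N×r}`, of `R ∈ 𝔽₂^{r×N}`, and one block of
`s × ℓ` labels per row for the sparse encoder. [cite: GajulapalliEtAl2023, Thm. 2 (proof)] -/
abbrev RigIn (N r s ℓ : ℕ) := (Fin N × Fin r) ⊕ (Fin r × Fin N) ⊕ (Fin N × Fin s × Fin ℓ)

/-- `|RigIn| = N·r + r·N + N·s·ℓ` (GGNS: `2rn + 2sn^{3/2}` with `ℓ = 2√n`).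
[cite: GajulapalliEtAl2023, Thm. 2 (proof: «The number of inputs of g is n' = 2rn + 2sn^{3/2}»)] -/
theorem card_rigIn (N r s ℓ : ℕ) : Fintype.card (RigIn N r s ℓ) = N * r + r * N + N * (s * ℓ) := by
  simp only [RigIn, Fintype.card_sum, Fintype.card_prod, Fintype.card_fin, Nat.add_assoc]

/-- **GGNS's degree-2 map `g(L, R, X) = L·R + S(X)`**: output `(i, j)` is the dot product of row `i` of `L` with
column `j` of `R` plus the `j`-th output of the sparse encoder on row `i`'s labels — a sum of `r + s` monomials
of degree `2` when `e` is a graph. [cite: GajulapalliEtAl2023, Thm. 2 (proof)] -/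
def rigidityMap {ℓ : ℕ} (e : Fin N → Finset (Fin ℓ)) (r s : ℕ) (w : RigIn N r s ℓ → ZMod 2) :
    Fin N × Fin N → ZMod 2 :=
  fun p => (∑ k : Fin r, w (Sum.inl (p.1, k)) * w (Sum.inr (Sum.inl (k, p.2)))) +
    sparseEnc e s (fun k j => w (Sum.inr (Sum.inr (p.1, k, j)))) p.2

/-- **GGNS Theorem 2 (the containment).**  Every matrix of the form `L·R + S` with `L ∈ 𝔽₂^{N×r}`,
`R ∈ 𝔽₂^{r×N}` and `S` `s`-row-sparse is in the range of `g` (graph `e` on the column indices: `N` distinct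
edges). [cite: GajulapalliEtAl2023, Thm. 2 (proof: «we constructed a degree-2 function g whose range contains
all non-rigid matrices»)] -/
theorem exists_rigidityMap_eq {ℓ r s : ℕ} (e : Fin N → Finset (Fin ℓ)) (he : ∀ j, (e j).card = 2)
    (hinj : Function.Injective e) (L : Matrix (Fin N) (Fin r) (ZMod 2)) (R : Matrix (Fin r) (Fin N) (ZMod 2))
    (S : Matrix (Fin N) (Fin N) (ZMod 2)) (hS : RowSparse s S) :
    ∃ w : RigIn N r s ℓ → ZMod 2, rigidityMap e r s w = fun p => (L * R + S) p.1 p.2 := by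
  have hrow : ∀ i, ∃ X : Fin s → Fin ℓ → ZMod 2, sparseEnc e s X = S i :=
    fun i => exists_sparseEnc_eq e he two_pos hinj (S i) (hS i)
  choose X hX using hrow
  refine ⟨fun c => match c with
      | Sum.inl (i, k) => L i k
      | Sum.inr (Sum.inl (k, j)) => R k j
      | Sum.inr (Sum.inr (i, k, j)) => X i k j, funext fun p => ?_⟩
  simp only [rigidityMap, Matrix.add_apply, Matrix.mul_apply]
  congr 1
  exact congrFun (hX p.1) p.2

/-- **GGNS Theorem 2 (as used): a solution of degree-2-AVOID on `g` is an `(r, s)`-rigid matrix.**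
[cite: GajulapalliEtAl2023, Thm. 2 (proof: «A solution to degree-2-AVOID on input g would therefore give an
(r, s)-rigid matrix»)] -/
theorem isRigid_of_not_mem_range {ℓ r s : ℕ} (e : Fin N → Finset (Fin ℓ)) (he : ∀ j, (e j).card = 2)
    (hinj : Function.Injective e) (y : Fin N × Fin N → ZMod 2)
    (hy : y ∉ Set.range (rigidityMap e r s)) : IsRigid r s (Matrix.of fun i j => y (i, j)) := by
  intro L R S hS hM
  apply hy
  obtain ⟨w, hw⟩ := exists_rigidityMap_eq e he hinj L R S hS
  refine ⟨w, ?_⟩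
  rw [hw, ← hM]
  funext p
  simp

/-- Rank `≤ r` gives a factorisation through `𝔽₂ʳ` («`Q = L·R` for some matrices `L, Rᵀ ∈ 𝔽₂^{n×r}`»: columns
of `Q` in a basis of the column space, padded with zero columns). [cite: GajulapalliEtAl2023, Thm. 2 (proof)] -/
theorem exists_mul_eq_of_rank_le {r : ℕ} (Q : Matrix (Fin N) (Fin N) (ZMod 2)) (h : Q.rank ≤ r) :
    ∃ (L : Matrix (Fin N) (Fin r) (ZMod 2)) (R : Matrix (Fin r) (Fin N) (ZMod 2)), Q = L * R := by
  classical
  set W : Submodule (ZMod 2) (Fin N → ZMod 2) := Submodule.span (ZMod 2) (Set.range Q.col) with hW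
  have hfin : Module.finrank (ZMod 2) W = Q.rank := (Q.rank_eq_finrank_span_cols).symm
  set ρ := Module.finrank (ZMod 2) W with hρdef
  let bW : Module.Basis (Fin ρ) (ZMod 2) W := Module.finBasis (ZMod 2) W
  have hρ : ρ ≤ r := hfin ▸ h
  have hcol : ∀ j, Q.col j ∈ W := fun j => Submodule.subset_span ⟨j, rfl⟩
  let c : Fin N → Fin ρ → ZMod 2 := fun j t => bW.repr ⟨Q.col j, hcol j⟩ t
  have hexp : ∀ i j, Q i j = ∑ t : Fin ρ, (bW t : Fin N → ZMod 2) i * c j t := by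
    intro i j
    have h1 : (⟨Q.col j, hcol j⟩ : W) = ∑ t, c j t • bW t := (bW.sum_repr _).symm
    have h2 : (Q.col j : Fin N → ZMod 2) = ∑ t, c j t • (bW t : Fin N → ZMod 2) := by
      have := congrArg (fun w : W => (w : Fin N → ZMod 2)) h1
      simpa [Submodule.coe_sum] using this
    have h3 := congrFun h2 i
    simp only [Matrix.col_apply, Finset.sum_apply, Pi.smul_apply, smul_eq_mul] at h3
    rw [h3]
    exact Finset.sum_congr rfl fun t _ => mul_comm _ _
  refine ⟨fun i k => if hk : (k : ℕ) < ρ then (bW ⟨k, hk⟩ : Fin N → ZMod 2) i else 0,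
          fun k j => if hk : (k : ℕ) < ρ then c j ⟨k, hk⟩ else 0, ?_⟩
  ext i j
  rw [Matrix.mul_apply, hexp i j]
  let G : ℕ → ZMod 2 := fun k => if hk : k < ρ then (bW ⟨k, hk⟩ : Fin N → ZMod 2) i * c j ⟨k, hk⟩ else 0
  have hl : (∑ t : Fin ρ, (bW t : Fin N → ZMod 2) i * c j t) = ∑ k ∈ Finset.range ρ, G k := by
    rw [← Fin.sum_univ_eq_sum_range]
    exact Finset.sum_congr rfl fun t _ => by simp [G, t.2]
  have hr : (∑ k : Fin r, (if hk : (k : ℕ) < ρ then (bW ⟨k, hk⟩ : Fin N → ZMod 2) i else 0) *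
      (if hk : (k : ℕ) < ρ then c j ⟨k, hk⟩ else 0)) = ∑ k ∈ Finset.range r, G k := by
    rw [← Fin.sum_univ_eq_sum_range]
    refine Finset.sum_congr rfl fun k _ => ?_
    by_cases hk : (k : ℕ) < ρ
    · simp [G, hk]
    · simp [G, hk]
  rw [hl, hr]
  apply Finset.sum_subset (Finset.range_subset_range.2 hρ)
  intro k hk hk'
  have : ¬ k < ρ := by simpa using hk'
  simp [G, this]

/-- `IsRigid r s` is `(r, s)`-rigidity exactly as printed, with «rank-`r` matrix» read through `Matrix.rank`:
`M ≠ Q + S` for every `Q` of rank `≤ r` and every `s`-row-sparse `S`.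
[cite: GajulapalliEtAl2023, §1.1 ((r,s)-rigid)] -/
theorem isRigid_iff_rank {r s : ℕ} (M : Matrix (Fin N) (Fin N) (ZMod 2)) :
    IsRigid r s M ↔ ∀ (Q S : Matrix (Fin N) (Fin N) (ZMod 2)), Q.rank ≤ r → RowSparse s S → M ≠ Q + S := by
  constructor
  · intro h Q S hQ hS hM
    obtain ⟨L, R, hLR⟩ := exists_mul_eq_of_rank_le Q hQ
    exact h L R S hS (by rw [hM, hLR])
  · intro h L R S hS hM
    exact h (L * R) S (rank_mul_le L R) hS hM

end Rigidity

end DegreeTwoAvoid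

end Literature.Computability.Complexity
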